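import Summits.AnomalousDissipation.AnomalousDissipation.Theses.StirringSphere
import HarnessLib

/-!
# Crux `HairyBallAlignment` (stmt-AnomalousDissipation-17155, route StirringSphere, rank 9) — birth skeleton

`Lines/birth.lean` (registrar seat `planner-skel-stmt-AnomalousDissipation-17155-0`, mode
skeleton-register / BC3, 2026-08-17).

THE CRUX (`Summit.AnomalousDissipation.AnomalousDissipation.Theses.StirringSphere.HairyBallAlignment`,
the TOPOLOGICAL STEP of the route): `NoScreening → BoundedSphereStatistics → ∀ b = (b₀,b₁,b₂)` (the
explicit stirring family) `→ ∃ E ν₀ m₀ > 0, ∀ ν ∈ (0,ν₀), ∃ c ∈ S², ∃ μ` a Foias–Prodi stationary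
statistical solution of `NS_ν(f_c)`, `f_c = Σ cᵢ bᵢ`, with integrable mean energy `≤ E` and
INJECTION `∫ (u, f_c) dμ(u) ≥ m₀` — "at every small viscosity some force of the stirring sphere is
exactly aligned with its own mean-flow response, hence loud".

THE LINE (the route's own two-layer plan, sharpened by the grounder / refuter notes on the item:
closed graph of bounded statistics at fixed `ν` → set-valued hairy ball): write
`y(μ) = (∫ (u, bᵢ) dμ)ᵢ ∈ ℝ³` for the MEAN-FLOW RESPONSE VECTOR of a statistics `μ` and
`K_{ν,E}(c) = {y(μ) : μ admissible for (ν, E, c)}` for the RESPONSE SET of the direction `c ∈ S²`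
(admissible = stationary statistical solution of `NS_ν(f_c)` with integrable energy `≤ E`). Then
* BUDGET (stub 1): `K` is bounded uniformly on the sphere, injection is the RADIAL component of the
  response, `∫ (u, f_c) dμ = Σ cᵢ yᵢ(μ) = c · y(μ)`, and it is `≥ ν·(mean enstrophy) ≥ 0`
  (FMRT IV (1.31) with `e₁ = 0`, `e₂ = ∞`, in tree `IsStationaryStatisticalSolution.energy_le_holds`):
  `K(c)` lies in the closed hemisphere over `c`;
* CONVEX (stub 2): `K(c)` is convex (the Foias–Prodi class is convex in `μ`: probability, finite
  enstrophy, the Liouville identity, every shell energy inequality and the energy cap are linear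
  in `μ`, and `y` is affine);
* CLOSED GRAPH (stub 3, the crux's recorded risk, hardest): at fixed `ν > 0` the graph
  `{(c, y) : c ∈ S², y ∈ K_{ν,E}(c)}` is closed in `ℝ³ × ℝ³` (weak limits of bounded stationary
  statistics of `f_{c_n}`, `c_n → c`, are bounded stationary statistics of `f_c`: uniform support
  ball `‖u‖ ≤ ‖f_c‖₂/(4π²ν)` (`IsStationaryStatisticalSolution.ae_norm_le`) + mean enstrophy
  `≤ ‖f‖√E/ν` + Rellich ⇒ tight in `H`; Liouville identity and `∫‖u‖²` pass to the limit as bounded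
  continuous functionals on the support ball; finite enstrophy by lower semicontinuity; the SHELL
  energy inequalities pass on open shells with `μ`-null boundary and are recovered on `[e₁, e₂)`
  by dominated convergence);
* SET-VALUED HAIRY BALL (stub 4, topology): a closed-graph, bounded, nonempty-convex-valued field
  of sets `K(c) ⊂ {y : c · y ≥ 0}` over `S² ⊂ ℝ³` has a POSITIVELY ALIGNED point, `y ∈ K(c)` with
  `y = ‖y‖ c` (else the tangential parts `y − (c·y)c` omit `0`, strict separation + upper
  hemicontinuity + a partition of unity (equivalently Cellina's approximate selection,
  `Literature.Analysis.Convex.BorweinLewis2000_cellina`) give a continuous nowhere-zero tangent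
  field on `S²`, contradicting `Literature.Topology.Euclidean.HairyBall.exists_eq_zero_of_tangent`,
  `finrank ℝ³ = 3` odd);
* COMPOSITION `HairyBallAlignment_of` (kernel-checked, no `sorry` of its own): take `E, ν₀` from
  `BoundedSphereStatistics` (nonempty values), `ν₁, m₀` from `NoScreening` at level `E`
  (`|y| ≥ m₀` on every `K_{ν,E}(c)`, `ν < ν₁`), `ν₀' = min ν₀ ν₁`; at `ν < ν₀'` stub 4 applied to
  `K_{ν,E}` (hypotheses from stubs 1–3 and Bounded) yields `c, μ` with `y(μ) = ‖y(μ)‖ c`, whence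
  injection `= c · y(μ) = ‖y(μ)‖ ≥ m₀`.

STUBS (4): `stub_responseBudget` (provable now, M), `stub_responseConvex` (provable now, M),
`stub_responseGraphClosed` (HARDEST — the crux's why-might-fail; L), `stub_setValuedHairyBall`
(provable, L; Cellina + hairy ball, both grounded in tree). No stub restates the crux (none
produces a statistics AND an alignment; 1–3 are fixed-`ν`, per-direction structure of the
Foias–Prodi class, 4 is pure finite-dimensional topology) or the summit.

Disproof used: none exists — `ledger crux ls stmt-AnomalousDissipation-17155` lists no workfiles
(no `Disproof.lean`, no `Negative/`, no earlier line) on 2026-08-17; the negatives index of the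
summit (`GPEnergyCeiling`, `EnsembleCeilingBridge`, …) concerns energy CEILINGS for fixed forces and
is not touched by any stub (all energy clauses here are hypotheses `≤ E`, existential over
statistics, exactly as in the crux).

BC3 probes (registrar, 2026-08-17; files `bc/probe_<stub>.lean` of the registrar's folder, each importing
the ROUTE FILE only — not this file, so no pre-composed witness is in scope — and restating this file's
vocabulary verbatim). For every stub `S ∈ {responseBudget, responseConvex, responseGraphClosed,
setValuedHairyBall}` and each target `T ∈ {HairyBallAlignment, _root_.AnomalousDissipation}`, five
probes under `set_option maxHeartbeats 400000`: (1) `example : S_def → T := by first | exact? |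
simpa [S_def] | (unfold S_def; simpa) | aesop` (BC2 recipe, def-wrapped), (2) `example : (S inline) → T
:= by first | exact? | simpa | aesop`, (3)–(5) `exact?`, `simpa`, `aesop` alone. ALL 40 FAIL (40/40;
required 8/8): combined forms end in "unsolved goals" with `aesop: failed to prove the goal after
exhaustive search`; `exact?` "could not close the goal" (8/8); `simpa` "Tactic `assumption` failed"
(8/8); `aesop` exhaustive-search failure (8/8); no probe timed out. Advisory dedup (`bc/probe_dedup.lean`,
importing in addition CellinaSelection, HairyBall, StatisticalSolutionProofs/EnergyEq, StatisticalSolutions):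
`example : S := by unfold S; exact?` and `… aesop` FAIL for all four stubs (`exact?` could not close ×3,
whnf timeout ×1; aesop exhaustive ×3, rule cap ×1) — no stub is a known theorem, none is cheaply the
crux or the summit: 1–3 are fixed-`ν`, per-direction structure facts of the Foias–Prodi class producing
no statistics and no alignment, 4 is vocabulary-free finite-dimensional topology.

References: Foias–Manley–Rosa–Temam 2001, Ch. IV §1.2 Def. 1.3, (1.29)–(1.34) [FMRTTurbulence2001];
Doering–Foias 2002 §2 [DoeringFoias2002]; Milnor 1978 (hairy ball) [Milnor1978]; Cellina 1969,
doi:10.1007/bf02410784; Borwein–Lewis 2000 Thm 8.2.5 [BorweinLewis2000].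
-/

-- `Summit.<Summit>.<Problem>`: single-conjunct summit, the duplicated namespace component is mandated (CONVENTIONS §2).
set_option linter.dupNamespace false

noncomputable section

open MeasureTheory Filter Topology
open scoped InnerProductSpace RealInnerProductSpace ENNReal NNReal BigOperators
open Literature.Analysis.FunctionSpaces Literature.Analysis.FluidPDE
open Summit.AnomalousDissipation.AnomalousDissipation.Theses.StirringSphere

namespace Summit.AnomalousDissipation.AnomalousDissipation.Cruxes.HairyBallAlignment.Birth

/-! ## Vocabulary: the stirring family, admissible statistics, the response vector and the response set -/

/-- The explicit STIRRING FAMILY `b = (b₀, b₁, b₂)` on `T³` — VERBATIM the tuple `b` pinned by the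
hypothesis `b = ![…]` of every item of route StirringSphere (`b₀ = f_GP`, `b₁` its anti-cyclic cosine
partner, `b₂` on the shell `|k|² = 2`). -/
def stir : Fin 3 → UnitAddTorus (Fin 3) → EuclideanSpace ℝ (Fin 3) :=
  ![(fun x : UnitAddTorus (Fin 3) => (Literature.Analysis.FluidPDE.Torus.stokesMode (Pi.single (2 : Fin 3) (1 : ℤ)) (EuclideanSpace.single (0 : Fin 3) (1 : ℝ)) false x
        + Literature.Analysis.FluidPDE.Torus.stokesMode (Pi.single (0 : Fin 3) (1 : ℤ)) (EuclideanSpace.single (1 : Fin 3) (1 : ℝ)) false x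
        + Literature.Analysis.FluidPDE.Torus.stokesMode (Pi.single (1 : Fin 3) (1 : ℤ)) (EuclideanSpace.single (2 : Fin 3) (1 : ℝ)) false x : EuclideanSpace ℝ (Fin 3))),
    (fun x : UnitAddTorus (Fin 3) => (Literature.Analysis.FluidPDE.Torus.stokesMode (Pi.single (1 : Fin 3) (1 : ℤ)) (EuclideanSpace.single (0 : Fin 3) (1 : ℝ)) true x
        + Literature.Analysis.FluidPDE.Torus.stokesMode (Pi.single (2 : Fin 3) (1 : ℤ)) (EuclideanSpace.single (1 : Fin 3) (1 : ℝ)) true x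
        + Literature.Analysis.FluidPDE.Torus.stokesMode (Pi.single (0 : Fin 3) (1 : ℤ)) (EuclideanSpace.single (2 : Fin 3) (1 : ℝ)) true x : EuclideanSpace ℝ (Fin 3))),
    (fun x : UnitAddTorus (Fin 3) => (Literature.Analysis.FluidPDE.Torus.stokesMode ![(0 : ℤ), 1, 1] (EuclideanSpace.single (0 : Fin 3) (1 : ℝ)) false x
        + Literature.Analysis.FluidPDE.Torus.stokesMode ![(1 : ℤ), 0, 1] (EuclideanSpace.single (1 : Fin 3) (1 : ℝ)) false x
        + Literature.Analysis.FluidPDE.Torus.stokesMode ![(1 : ℤ), 1, 0] (EuclideanSpace.single (2 : Fin 3) (1 : ℝ)) false x : EuclideanSpace ℝ (Fin 3)))]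

/-- `stir` IS the route's literal (by `rfl`): the term to feed the items' `b = ![…]` binder. -/
theorem stir_eq : stir = ![(fun x : UnitAddTorus (Fin 3) => (Literature.Analysis.FluidPDE.Torus.stokesMode (Pi.single (2 : Fin 3) (1 : ℤ)) (EuclideanSpace.single (0 : Fin 3) (1 : ℝ)) false x + Literature.Analysis.FluidPDE.Torus.stokesMode (Pi.single (0 : Fin 3) (1 : ℤ)) (EuclideanSpace.single (1 : Fin 3) (1 : ℝ)) false x + Literature.Analysis.FluidPDE.Torus.stokesMode (Pi.single (1 : Fin 3) (1 : ℤ)) (EuclideanSpace.single (2 : Fin 3) (1 : ℝ)) false x : EuclideanSpace ℝ (Fin 3))), (fun x : UnitAddTorus (Fin 3) => (Literature.Analysis.FluidPDE.Torus.stokesMode (Pi.single (1 : Fin 3) (1 : ℤ)) (EuclideanSpace.single (0 : Fin 3) (1 : ℝ)) true x + Literature.Analysis.FluidPDE.Torus.stokesMode (Pi.single (2 : Fin 3) (1 : ℤ)) (EuclideanSpace.single (1 : Fin 3) (1 : ℝ)) true x + Literature.Analysis.FluidPDE.Torus.stokesMode (Pi.single (0 : Fin 3) (1 : ℤ)) (EuclideanSpace.single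 (2 : Fin 3) (1 : ℝ)) true x : EuclideanSpace ℝ (Fin 3))), (fun x : UnitAddTorus (Fin 3) => (Literature.Analysis.FluidPDE.Torus.stokesMode ![(0 : ℤ), 1, 1] (EuclideanSpace.single (0 : Fin 3) (1 : ℝ)) false x + Literature.Analysis.FluidPDE.Torus.stokesMode ![(1 : ℤ), 0, 1] (EuclideanSpace.single (1 : Fin 3) (1 : ℝ)) false x + Literature.Analysis.FluidPDE.Torus.stokesMode ![(1 : ℤ), 1, 0] (EuclideanSpace.single (2 : Fin 3) (1 : ℝ)) false x : EuclideanSpace ℝ (Fin 3)))] := rfl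

/-- ADMISSIBLE STATISTICS for viscosity `ν`, energy level `E` and direction `c ∈ ℝ³`: a Foias–Prodi
stationary statistical solution `μ` of `NS_ν(f_c)`, `f_c = Σ cᵢ bᵢ` (written exactly as in the route
items), with integrable mean energy `∫ ‖u‖² dμ ≤ E`. -/
def Admissible (ν E : ℝ) (c : EuclideanSpace ℝ (Fin 3)) (μ : Measure (Torus.energySpace (Fin 3))) : Prop :=
  Torus.IsStationaryStatisticalSolution ν (fun x : UnitAddTorus (Fin 3) => ∑ i : Fin 3, c i • stir i x) μ ∧
    Integrable (fun u : Torus.energySpace (Fin 3) => ‖u‖ ^ 2) μ ∧ Torus.ensembleEnergy μ ≤ E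

/-- The MEAN-FLOW RESPONSE VECTOR `y(μ) ∈ ℝ³`, `yᵢ(μ) = ∫ (u, bᵢ) dμ(u)` (the low-mode mean flow of the
statistics `μ` read in the stirring family; `(·,·)` = `Torus.pairing`, the `L²` pairing of FMRT IV §1.1). -/
def response (μ : Measure (Torus.energySpace (Fin 3))) : EuclideanSpace ℝ (Fin 3) :=
  WithLp.toLp 2 fun i : Fin 3 =>
    ∫ u, Torus.pairing (u : Lp (EuclideanSpace ℝ (Fin 3)) 2 (volume : Measure (UnitAddTorus (Fin 3)))) (stir i) ∂μ

/-- The RESPONSE SET `K_{ν,E}(c) = {y(μ) : μ admissible for (ν, E, c)} ⊂ ℝ³`. -/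
def responseSet (ν E : ℝ) (c : EuclideanSpace ℝ (Fin 3)) : Set (EuclideanSpace ℝ (Fin 3)) :=
  {y | ∃ μ : Measure (Torus.energySpace (Fin 3)), Admissible ν E c μ ∧ response μ = y}

/-! ## The four stub statements (named; the stubs below restate them verbatim) -/

/-- STUB 1 statement — THE RESPONSE BUDGET (uniform bound, radial component = injection ≥ 0). -/
def ResponseBudget : Prop :=
  ∀ ν E : ℝ, 0 < ν → ∃ R : ℝ, ∀ (c : EuclideanSpace ℝ (Fin 3)) (μ : Measure (Torus.energySpace (Fin 3))),
    ‖c‖ = 1 → Admissible ν E c μ →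
      ‖response μ‖ ≤ R ∧
        ∫ u, Torus.pairing (u : Lp (EuclideanSpace ℝ (Fin 3)) 2 (volume : Measure (UnitAddTorus (Fin 3))))
            (fun x : UnitAddTorus (Fin 3) => ∑ i : Fin 3, c i • stir i x) ∂μ = ∑ i : Fin 3, c i * response μ i ∧
          0 ≤ ∫ u, Torus.pairing (u : Lp (EuclideanSpace ℝ (Fin 3)) 2 (volume : Measure (UnitAddTorus (Fin 3))))
            (fun x : UnitAddTorus (Fin 3) => ∑ i : Fin 3, c i • stir i x) ∂μ

/-- STUB 2 statement — CONVEXITY of every response set. -/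
def ResponseConvex : Prop :=
  ∀ (ν E : ℝ) (c : EuclideanSpace ℝ (Fin 3)), Convex ℝ (responseSet ν E c)

/-- STUB 3 statement — CLOSED GRAPH of the response sets over the sphere, at fixed `ν > 0`. -/
def ResponseGraphClosed : Prop :=
  ∀ ν E : ℝ, 0 < ν →
    IsClosed {p : EuclideanSpace ℝ (Fin 3) × EuclideanSpace ℝ (Fin 3) | ‖p.1‖ = 1 ∧ p.2 ∈ responseSet ν E p.1}

/-- STUB 4 statement — THE SET-VALUED HAIRY BALL THEOREM on `S² ⊂ ℝ³` (hemisphere-valued version). -/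
def SetValuedHairyBall : Prop :=
  ∀ K : EuclideanSpace ℝ (Fin 3) → Set (EuclideanSpace ℝ (Fin 3)),
    IsClosed {p : EuclideanSpace ℝ (Fin 3) × EuclideanSpace ℝ (Fin 3) | ‖p.1‖ = 1 ∧ p.2 ∈ K p.1} →
    (∃ R : ℝ, ∀ (c y : EuclideanSpace ℝ (Fin 3)), ‖c‖ = 1 → y ∈ K c → ‖y‖ ≤ R) →
    (∀ c : EuclideanSpace ℝ (Fin 3), ‖c‖ = 1 → Convex ℝ (K c)) →
    (∀ c : EuclideanSpace ℝ (Fin 3), ‖c‖ = 1 → (K c).Nonempty) →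
    (∀ (c y : EuclideanSpace ℝ (Fin 3)), ‖c‖ = 1 → y ∈ K c → 0 ≤ ⟪c, y⟫_ℝ) →
      ∃ (c y : EuclideanSpace ℝ (Fin 3)), ‖c‖ = 1 ∧ y ∈ K c ∧ y = ‖y‖ • c

/-! ## The stubs -/

/-- **stub 1 — the response budget** (provable now; size M; the dictionary between injection and the
response vector). For `ν > 0` and every energy level `E` there is `R` such that every admissible
statistics `μ` of any direction `c ∈ S²` has (i) `‖y(μ)‖ ≤ R` — by Cauchy–Schwarz twice,
`|yᵢ| ≤ ∫ |(u,bᵢ)| dμ ≤ ‖bᵢ‖₂ ∫‖u‖ dμ ≤ ‖bᵢ‖₂ √(∫‖u‖² dμ) ≤ ‖bᵢ‖₂ √E` (`μ` is a probability measure;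
in tree `abs_pairing_coe_le`, `IsStationaryStatisticalSolution.integrable_pairing`; also from the support
ball `IsStationaryStatisticalSolution.ae_norm_le`), so `R = 3√(max E 0)` works (`‖bᵢ‖₂² = 3/2`);
(ii) INJECTION IS THE RADIAL COMPONENT OF THE RESPONSE, `∫ (u, f_c) dμ = Σᵢ cᵢ yᵢ(μ)` — linearity of the
`L²` pairing in the field (`(u, Σ cᵢbᵢ) = Σ cᵢ (u, bᵢ)` pointwise in `u`, all integrands integrable since
`bᵢ` is continuous on the compact torus) and of the Bochner integral in `μ` (each `u ↦ (u, bᵢ)` is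
continuous on `H` and `μ`-integrable by `integrable_pairing`); (iii) `0 ≤ ∫ (u, f_c) dμ` — the mean
energy inequality `ν ∫‖∇u‖² dμ ≤ ∫ (f_c, u) dμ` (FMRT IV (1.31) with `e₁ = 0`, `e₂ = ∞`; PROVED in tree:
`IsStationaryStatisticalSolution.energy_le_holds`, needs `MemLp f_c 2` — `f_c` is a trigonometric
polynomial) and `ν > 0`. Why it might fail: only by a slip in (ii)'s integrability side conditions
(then add `Integrable` clauses; the composition uses (ii) only for admissible `μ`). Leans on:
StatisticalSolutionProofs / StatisticalSolutionEnergyEq (tree), `EuclideanSpace.real_norm_sq_eq`.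
[FMRTTurbulence2001 Ch. IV (1.31)–(1.34); DoeringFoias2002 §2] -/
theorem stub_responseBudget :
    ∀ ν E : ℝ, 0 < ν → ∃ R : ℝ, ∀ (c : EuclideanSpace ℝ (Fin 3)) (μ : Measure (Torus.energySpace (Fin 3))),
      ‖c‖ = 1 → Admissible ν E c μ →
        ‖response μ‖ ≤ R ∧
          ∫ u, Torus.pairing (u : Lp (EuclideanSpace ℝ (Fin 3)) 2 (volume : Measure (UnitAddTorus (Fin 3))))
              (fun x : UnitAddTorus (Fin 3) => ∑ i : Fin 3, c i • stir i x) ∂μ = ∑ i : Fin 3, c i * response μ i ∧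
            0 ≤ ∫ u, Torus.pairing (u : Lp (EuclideanSpace ℝ (Fin 3)) 2 (volume : Measure (UnitAddTorus (Fin 3))))
              (fun x : UnitAddTorus (Fin 3) => ∑ i : Fin 3, c i • stir i x) ∂μ := by
  sorry

/-- **stub 2 — convexity of the response sets** (provable now; size M). For all `ν, E, c` the set
`K_{ν,E}(c)` is convex: given admissible `μ₀, μ₁` and `t ∈ [0,1]`, the measure
`μ_t = (1 − t) μ₀ + t μ₁` is admissible — `IsProbabilityMeasure` ✓, finite mean enstrophy
(`lintegral_add_measure`, `lintegral_smul_measure`) ✓, the Liouville identity `∫ ⟨F(u), Φ'(u)⟩ dμ_t = 0`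
with its integrability clause (`Integrable.add_measure`, `integral_add_measure`) ✓, every shell energy
inequality `∫_{e₁ ≤ |u|² < e₂} (ν‖u‖²_V − (f,u)) dμ_t ≤ 0` ✓ (if the integrand is integrable on the shell
for both measures the set integral is the convex combination of two nonpositive numbers; if it is not
integrable for one of them it is not integrable for `μ_t`, `0 < t < 1`, and the Bochner junk value `0 ≤ 0`
holds — all four junk cases check), `Integrable ‖u‖²` and `∫‖u‖² dμ_t = (1−t)E₀ + tE₁ ≤ E` ✓ — and
`y(μ_t) = (1 − t) y(μ₀) + t y(μ₁)` (`integral_add_measure`, `integral_smul_measure`, integrability of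
`u ↦ (u, bᵢ)` from stub 1's proof). Why it might fail: it should not (pure measure bookkeeping; the
only trap is the `ℝ≥0∞`-vs-`ℝ` scalar action on `Measure`, use `t.toNNReal`). Leans on: Mathlib measure
algebra; `IsStationaryStatisticalSolution` (structure, four fields). [FMRTTurbulence2001 Ch. IV §1.2
(the class of stationary statistical solutions is convex)] -/
theorem stub_responseConvex :
    ∀ (ν E : ℝ) (c : EuclideanSpace ℝ (Fin 3)), Convex ℝ (responseSet ν E c) := by
  sorry

/-- **stub 3 — closed graph of the bounded Foias–Prodi class over the stirring sphere, at fixed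
`ν > 0`** (the HARDEST stub = the crux's recorded why-might-fail; size L). If `c_n → c` on `S²`,
`μ_n` admissible for `(ν, E, c_n)` and `y(μ_n) → y`, then `y = y(μ)` for some `μ` admissible for
`(ν, E, c)`. Route of proof (FMRT IV §1 tools, all fixed-`ν`): (a) TIGHTNESS in the norm topology of
`H`: every `μ_n` is carried by the ball `‖u‖ ≤ ‖f_{c_n}‖₂/(4π²ν) = √(3/2)/(4π²ν)` (in tree
`IsStationaryStatisticalSolution.ae_norm_le`) and has mean enstrophy `≤ ‖f‖₂√E/ν`
(`energy_le_holds` + Cauchy–Schwarz), and `{‖∇u‖² ≤ M} ∩ H` is compact in `H` (Rellich on `T³`,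
Poincaré on mean-zero fields) ⇒ Prokhorov gives a narrow limit `μ` (probability ✓); (b) the Liouville
identity `∫ ⟨F_{c_n}(u), Φ'(u)⟩ dμ_n = 0` passes to the limit for every cylindrical `Φ`: the integrand
is continuous on `H` (all derivatives on the smooth `Φ'(u) = Σ ∂ⱼφ((u,g)) gⱼ`, `φ ∈ C¹_c`), bounded on
the common support ball, and depends on `c_n` only through the bounded linear term `(f_{c_n}, Φ'(u))`;
(c) `∫‖u‖² dμ ≤ E` and `y(μ) = lim y(μ_n) = y` (bounded continuous functionals on the support ball);
(d) finite mean enstrophy by lower semicontinuity of `u ↦ ‖∇u‖²` on `H` and Fatou/portmanteau;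
(e) THE SHELL ENERGY INEQUALITIES (1.31): from the shells of `μ_n` obtain the weighted inequalities
`∫ ψ(|u|²)(ν‖∇u‖² − (f_{c_n},u)) dμ_n ≤ 0` for continuous unimodal `ψ ≥ 0` (layer-cake over open
shells, dominated convergence from `[e₁+1/k, e₂)`), pass to the limit (`ψ·‖∇·‖²` is lsc `≥ 0`, the
pairing part is bounded continuous on the ball), and recover every half-open shell `[e₁, e₂)`,
`e₂ ≤ ∞`, for `μ` by dominated convergence `ψ_k → 1_{[e₁,e₂)}` (the integrand is `μ`-integrable:
`integrable_toReal_eGradNormSq`, `integrable_pairing`; in the non-integrable junk case the Lean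
inequality holds trivially). Why it might fail (the crux's own risk, verbatim): the Foias–Prodi class
(ALL shell energy inequalities + integrability side conditions) may fail to be weakly closed at fixed
`ν` — concretely step (e) if some shell boundary carries mass for every approximating level, or step
(b) if the `Integrable` side condition of `generator` cannot be certified for the limit off the support
ball; then the class must be modified (time-average measures / open shells) and the crux restated over
it. Leans on: `IsStationaryStatisticalSolution.ae_norm_le`, `energy_le_holds`, `measurable_eGradNormSq_coe`
(tree); Mathlib `MeasureTheory.ProbabilityMeasure` (narrow topology), Prokhorov / tightness
(`IsTightMeasureSet`), Rellich on the torus (tree, TorusSobolev*). [FMRTTurbulence2001 Ch. IV §1.2–1.4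
(weak compactness of families of stationary statistical solutions, time-average measures);
FoiasRosaTemam2019 §5] -/
theorem stub_responseGraphClosed :
    ∀ ν E : ℝ, 0 < ν →
      IsClosed {p : EuclideanSpace ℝ (Fin 3) × EuclideanSpace ℝ (Fin 3) | ‖p.1‖ = 1 ∧ p.2 ∈ responseSet ν E p.1} := by
  sorry

/-- **stub 4 — the set-valued hairy ball theorem, hemisphere form** (provable; size L; pure
finite-dimensional topology). Let `K(c) ⊂ ℝ³` (`c ∈ S²`) have closed graph over the sphere, be
uniformly bounded, convex and nonempty, and lie in the closed hemisphere `{y : ⟪c, y⟫ ≥ 0}`. Then some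
`c ∈ S²` carries a POSITIVELY ALIGNED value: `y ∈ K(c)` with `y = ‖y‖ c`. Proof: if some `K(c)` meets
the ray `ℝ≥0·c ∪ {0}` we are done (`y = ⟪c,y⟫c` with `⟪c,y⟫ ≥ 0` is `y = ‖y‖c`). Otherwise every
tangential image `T(c) = P_{c^⊥} K(c)` is compact, convex, nonempty and omits `0`; strict separation
gives `v_c` with `⟪v_c, t⟫ ≥ ε_c > 0` on `T(c)`; closed graph + boundedness = upper hemicontinuity on
the compact `S²`, so the same `v_c` works on a neighbourhood `U_c` (else a sequence `(c_n, y_n)` in the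
graph with `⟪v_c, P_{c_n^⊥} y_n⟫ ≤ ε_c/2` has a limit point in `{c} × K(c)`, contradiction); a finite
partition of unity `ρⱼ` subordinate to `{U_{cⱼ}}` gives `w = Σ ρⱼ v_{cⱼ}` with `⟪w(c), t⟫ > 0` for all
`t ∈ T(c) ≠ ∅`, so the tangent field `c ↦ P_{c^⊥} w(c)` is continuous and nowhere zero on `S²` —
contradicting the hairy ball theorem, IN TREE: `Literature.Topology.Euclidean.HairyBall.exists_eq_zero_of_tangent`
(`Module.finrank ℝ (EuclideanSpace ℝ (Fin 3)) = 3` odd). Equivalently: Cellina's approximate selection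
(`Literature.Analysis.Convex.BorweinLewis2000_cellina`, named fact in tree, Borwein–Lewis Thm 8.2.5)
of the u.h.c. map `T`, projected to `c^⊥`, is a nowhere-zero tangent field for `ε` below the uniform
gap. Why it might fail: it does not as stated, and every hypothesis is load-bearing — without `Nonempty`,
`K = ∅` is a counterexample; without the hemisphere clause, `K(c) = {−c}` (closed graph, bounded, convex,
nonempty) has no value of the form `‖y‖ c`; without convexity, the unit tangent circle
`K(c) = {t ⊥ c : ‖t‖ = 1}` defeats it; without the closed graph, a discontinuous tangent selection plus
`c` itself off one point does. Leans on:
`exists_eq_zero_of_tangent` (tree), Mathlib `PartitionOfUnity` / `exists_continuous_forall_mem_convex_of_local`,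
`geometric_hahn_banach_point_closed` / finite-dimensional separation. [Milnor1978; Cellina 1969
doi:10.1007/bf02410784; BorweinLewis2000 Thm 8.2.5] -/
theorem stub_setValuedHairyBall :
    ∀ K : EuclideanSpace ℝ (Fin 3) → Set (EuclideanSpace ℝ (Fin 3)),
      IsClosed {p : EuclideanSpace ℝ (Fin 3) × EuclideanSpace ℝ (Fin 3) | ‖p.1‖ = 1 ∧ p.2 ∈ K p.1} →
      (∃ R : ℝ, ∀ (c y : EuclideanSpace ℝ (Fin 3)), ‖c‖ = 1 → y ∈ K c → ‖y‖ ≤ R) →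
      (∀ c : EuclideanSpace ℝ (Fin 3), ‖c‖ = 1 → Convex ℝ (K c)) →
      (∀ c : EuclideanSpace ℝ (Fin 3), ‖c‖ = 1 → (K c).Nonempty) →
      (∀ (c y : EuclideanSpace ℝ (Fin 3)), ‖c‖ = 1 → y ∈ K c → 0 ≤ ⟪c, y⟫_ℝ) →
        ∃ (c y : EuclideanSpace ℝ (Fin 3)), ‖c‖ = 1 ∧ y ∈ K c ∧ y = ‖y‖ • c := by
  sorry

/-! ## Name-keyed aliases of the stub statements — the hypotheses of `HairyBallAlignment_of`

The native skeleton audit (`#h21_check_skeleton`, run by `ledger skeleton check`) admits a hypothesis of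
the composing theorem only if its head constant is a registered obligation or is NAMED like a declared
stub; `__Registered.stub_X` is statement `X` under the registered stub's short name (device of
`Cruxes/EfficientAnchor/Lines/birth.lean`, `Cruxes/CyclicWindLineLoud/Lines/birth.lean`). Each alias is an
`abbrev`, definitionally its statement. -/
namespace __Registered

/-- Alias of `ResponseBudget` keyed by the registered stub name. -/
abbrev stub_responseBudget : Prop := ResponseBudget
/-- Alias of `ResponseConvex` keyed by the registered stub name. -/
abbrev stub_responseConvex : Prop := ResponseConvex
/-- Alias of `ResponseGraphClosed` keyed by the registered stub name. -/
abbrev stub_responseGraphClosed : Prop := ResponseGraphClosed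
/-- Alias of `SetValuedHairyBall` keyed by the registered stub name. -/
abbrev stub_setValuedHairyBall : Prop := SetValuedHairyBall

end __Registered

/-! Registered-signature agreement: each stub theorem's signature is, definitionally, the named statement
it witnesses (`Iff.rfl`; only TYPES are compared, no `sorry` enters). -/
example : (∀ ν E : ℝ, 0 < ν → ∃ R : ℝ, ∀ (c : EuclideanSpace ℝ (Fin 3)) (μ : Measure (Torus.energySpace (Fin 3))),
      ‖c‖ = 1 → Admissible ν E c μ →
        ‖response μ‖ ≤ R ∧
          ∫ u, Torus.pairing (u : Lp (EuclideanSpace ℝ (Fin 3)) 2 (volume : Measure (UnitAddTorus (Fin 3))))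
              (fun x : UnitAddTorus (Fin 3) => ∑ i : Fin 3, c i • stir i x) ∂μ = ∑ i : Fin 3, c i * response μ i ∧
            0 ≤ ∫ u, Torus.pairing (u : Lp (EuclideanSpace ℝ (Fin 3)) 2 (volume : Measure (UnitAddTorus (Fin 3))))
              (fun x : UnitAddTorus (Fin 3) => ∑ i : Fin 3, c i • stir i x) ∂μ) ↔
    __Registered.stub_responseBudget := Iff.rfl
example : (∀ (ν E : ℝ) (c : EuclideanSpace ℝ (Fin 3)), Convex ℝ (responseSet ν E c)) ↔
    __Registered.stub_responseConvex := Iff.rfl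
example : (∀ ν E : ℝ, 0 < ν →
      IsClosed {p : EuclideanSpace ℝ (Fin 3) × EuclideanSpace ℝ (Fin 3) | ‖p.1‖ = 1 ∧ p.2 ∈ responseSet ν E p.1}) ↔
    __Registered.stub_responseGraphClosed := Iff.rfl
example : (∀ K : EuclideanSpace ℝ (Fin 3) → Set (EuclideanSpace ℝ (Fin 3)),
      IsClosed {p : EuclideanSpace ℝ (Fin 3) × EuclideanSpace ℝ (Fin 3) | ‖p.1‖ = 1 ∧ p.2 ∈ K p.1} →
      (∃ R : ℝ, ∀ (c y : EuclideanSpace ℝ (Fin 3)), ‖c‖ = 1 → y ∈ K c → ‖y‖ ≤ R) →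
      (∀ c : EuclideanSpace ℝ (Fin 3), ‖c‖ = 1 → Convex ℝ (K c)) →
      (∀ c : EuclideanSpace ℝ (Fin 3), ‖c‖ = 1 → (K c).Nonempty) →
      (∀ (c y : EuclideanSpace ℝ (Fin 3)), ‖c‖ = 1 → y ∈ K c → 0 ≤ ⟪c, y⟫_ℝ) →
        ∃ (c y : EuclideanSpace ℝ (Fin 3)), ‖c‖ = 1 ∧ y ∈ K c ∧ y = ‖y‖ • c) ↔
    __Registered.stub_setValuedHairyBall := Iff.rfl

/-! ## Proved: a small lemma and the composition -/

/-- `⟪c, y⟫ = Σᵢ cᵢ yᵢ` on `ℝ³`. -/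
theorem inner_eq_sum (c y : EuclideanSpace ℝ (Fin 3)) : ⟪c, y⟫_ℝ = ∑ i : Fin 3, c i * y i := by
  simp [PiLp.inner_apply, mul_comm]

/-- **Composition** (kernel-checked, no `sorry` of its own): the four stub statements imply the crux
`Summit.AnomalousDissipation.AnomalousDissipation.Theses.StirringSphere.HairyBallAlignment` BY NAME.
`E, ν₀` from `BoundedSphereStatistics` (nonempty response sets on the whole sphere for `ν < ν₀`);
`ν₁, m₀` from `NoScreening` at level `E` (`‖y‖² ≥ m₀²` on every response set for `ν < ν₁`); for
`ν < min ν₀ ν₁` the set-valued hairy ball theorem (stub 4) applied to `K_{ν,E}` — closed graph (stub 3),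
bounded and hemisphere-valued (stub 1), convex (stub 2), nonempty (Bounded) — yields `c ∈ S²` and an
admissible `μ` with `y(μ) = ‖y(μ)‖ c`; then injection `= Σ cᵢ yᵢ = ‖y‖ Σ cᵢ² = ‖y‖ ≥ m₀`. [folklore] -/
theorem HairyBallAlignment_of :
    __Registered.stub_responseBudget → __Registered.stub_responseConvex →
      __Registered.stub_responseGraphClosed → __Registered.stub_setValuedHairyBall →
        HairyBallAlignment := by
  intro hBud hConv hCl hHB
  dsimp only [__Registered.stub_responseBudget, __Registered.stub_responseConvex,
    __Registered.stub_responseGraphClosed, __Registered.stub_setValuedHairyBall, ResponseBudget,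
    ResponseConvex, ResponseGraphClosed, SetValuedHairyBall] at hBud hConv hCl hHB
  intro hNS hBSS b hb
  obtain rfl : b = stir := hb
  -- bounded statistics on the whole sphere: the level `E` and the threshold `ν₀`
  obtain ⟨E, ν₀, hE, hν₀, hbdd⟩ := hBSS stir stir_eq
  -- no screening at level `E`: the threshold `ν₁` and the floor `m₀`
  obtain ⟨ν₁, m₀, hν₁, hm₀, hns⟩ := hNS stir stir_eq E hE
  refine ⟨E, min ν₀ ν₁, m₀, hE, lt_min hν₀ hν₁, hm₀, fun ν hν hνlt => ?_⟩
  have hν0 : ν < ν₀ := lt_of_lt_of_le hνlt (min_le_left _ _)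
  have hν1 : ν < ν₁ := lt_of_lt_of_le hνlt (min_le_right _ _)
  -- the hypotheses of the set-valued hairy ball theorem for `K = responseSet ν E`
  obtain ⟨R, hR⟩ := hBud ν E hν
  have hbound : ∀ (c y : EuclideanSpace ℝ (Fin 3)), ‖c‖ = 1 → y ∈ responseSet ν E c → ‖y‖ ≤ R := by
    rintro c y hc ⟨μ, hadm, rfl⟩
    exact (hR c μ hc hadm).1
  have hne : ∀ c : EuclideanSpace ℝ (Fin 3), ‖c‖ = 1 → (responseSet ν E c).Nonempty := by
    intro c hc
    obtain ⟨μ, hstat, hint, hEμ⟩ := hbdd c hc ν hν hν0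
    exact ⟨response μ, μ, ⟨hstat, hint, hEμ⟩, rfl⟩
  have hhemi : ∀ (c y : EuclideanSpace ℝ (Fin 3)), ‖c‖ = 1 → y ∈ responseSet ν E c → 0 ≤ ⟪c, y⟫_ℝ := by
    rintro c y hc ⟨μ, hadm, rfl⟩
    obtain ⟨-, hlin, hnn⟩ := hR c μ hc hadm
    rw [inner_eq_sum, ← hlin]
    exact hnn
  obtain ⟨c, y, hc, ⟨μ, hadm, hyμ⟩, hal⟩ :=
    hHB (responseSet ν E) (hCl ν E hν) ⟨R, hbound⟩ (fun c _ => hConv ν E c) hne hhemi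
  obtain ⟨-, hlin, -⟩ := hR c μ hc hadm
  refine ⟨c, μ, hc, hadm.1, hadm.2.1, hadm.2.2, ?_⟩
  -- no screening: `m₀² ≤ Σ yᵢ² = ‖y‖²`
  have hm : m₀ ^ 2 ≤ ∑ i : Fin 3, (response μ i) ^ 2 := hns c hc ν hν hν1 μ hadm.1 hadm.2.1 hadm.2.2
  have hy2 : m₀ ^ 2 ≤ ‖y‖ ^ 2 := by
    rw [EuclideanSpace.real_norm_sq_eq, ← hyμ]
    exact hm
  have hle : m₀ ≤ ‖y‖ := by
    have h := Real.sqrt_le_sqrt hy2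
    rwa [Real.sqrt_sq hm₀.le, Real.sqrt_sq (norm_nonneg y)] at h
  -- alignment: `y = ‖y‖ c`, so the radial component `Σ cᵢ yᵢ` is `‖y‖ Σ cᵢ² = ‖y‖`
  have hc2 : ∑ i : Fin 3, c i ^ 2 = 1 := by
    rw [← EuclideanSpace.real_norm_sq_eq, hc, one_pow]
  have hrad : ∑ i : Fin 3, c i * y i = ‖y‖ := by
    have h1 : ∀ i : Fin 3, c i * y i = ‖y‖ * c i ^ 2 := fun i => by
      conv_lhs => rw [hal]
      simp only [PiLp.smul_apply, smul_eq_mul]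
      ring
    simp_rw [h1]
    rw [← Finset.mul_sum, hc2, mul_one]
  -- injection `= Σ cᵢ yᵢ(μ) = ‖y‖ ≥ m₀`
  calc m₀ ≤ ‖y‖ := hle
    _ = ∑ i : Fin 3, c i * y i := hrad.symm
    _ = ∑ i : Fin 3, c i * response μ i := by rw [hyμ]
    _ = ∫ u, Torus.pairing (u : Lp (EuclideanSpace ℝ (Fin 3)) 2 (volume : Measure (UnitAddTorus (Fin 3))))
          (fun x : UnitAddTorus (Fin 3) => ∑ i : Fin 3, c i • stir i x) ∂μ := hlin.symm

/-- WIRING CHECK: the four sorried stubs compose to a closed term of the crux's type (modulo their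
`sorry`s). Deliberately an `example` (no constant enters the environment), so that a probe importing
this file could not close `stub → HairyBallAlignment` by `exact?` through a pre-composed witness. -/
example : HairyBallAlignment :=
  HairyBallAlignment_of stub_responseBudget stub_responseConvex stub_responseGraphClosed
    stub_setValuedHairyBall

end Summit.AnomalousDissipation.AnomalousDissipation.Cruxes.HairyBallAlignment.Birth

end
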